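import Literature.AlgebraicGeometry.Resolution.ChowLemmaRing
import Mathlib.AlgebraicGeometry.FunctionField
import Mathlib.AlgebraicGeometry.Morphisms.Finite
import Mathlib.AlgebraicGeometry.Morphisms.Proper
import Mathlib.LinearAlgebra.Complex.FiniteDimensional
import Mathlib.RingTheory.WittVector.Domain
import Mathlib.RingTheory.WittVector.Identities
import Mathlib.FieldTheory.Perfect
import Mathlib.RingTheory.WittVector.Teichmuller
import Mathlib.RingTheory.Flat.TorsionFree

/-!
# `FormalVectorBundlesAlgebraize` (stmt-HodgeConjecture-14106) · Negative · stub mutations of the line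
`chow-zariski-pushforward`

Support lemmas of the deep-refute seat of crux P3a of route `PadicSemiregularLift`
(refuter-drefute-stmt-HodgeConjecture-14106-0, 2026-08-16) on the registered stub set of the picked line
`Cruxes/FormalVectorBundlesAlgebraize/Lines/chow-zariski-pushforward.lean` (stubs `stub_integralNormal`,
`stub_chowCover`, `stub_birationalOntoNormal`, `stub_projectiveFlatEngine`, `stub_pushforwardTransport`).
No stub is false or misstated (briefing: `Cruxes/FormalVectorBundlesAlgebraize/Negative-notes/`); what is
kernel-checked here is the hypothesis-mutation analysis that IS decidable in the tree today:

* `surjective_of_dense_isIso_restrict` — in STUB 3 (`BirationalOntoNormal`, Stacks 0AY8 specialised) the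
  hypothesis `Surjective ρ` is REDUNDANT: a universally closed morphism that is an isomorphism over a dense
  open is surjective (closed map with dense image). Stub workers may discharge it instead of threading it.
* `isProper_left_of_isProjOver` — in STUB 5 (`PushforwardTransport`) the hypothesis `IsProper ρ.left` is
  REDUNDANT given `ChowLemmaRing.IsProjOver 𝒳'` and separatedness of `𝒳 → Spec W` (Mathlib
  `IsProper.of_comp`); likewise the `IsProper ρ.left` conjunct produced by STUB 2 (`ChowCover`).
* `not_chowCover_without_surjective` — the hypothesis `Surjective 𝒳.hom` of STUB 2 (`ChowCover`) is
  LOAD-BEARING: for the proper integral `𝒳 = Spec 𝔽₂` over `W(𝔽₂)` (concentrated on the closed point) no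
  `W`-flat `𝒳'` surjects onto `𝒳` (`2 = 0` on `𝒳'`, `2` regular on flat `W`-modules ⇒ `𝒳' = ∅`).
* `not_birationalOntoNormal_without_birational` — the birationality hypothesis of STUB 3
  (`∃ U dense, IsIso (ρ ∣_ U)`) is LOAD-BEARING: without it the statement is false, witness the finite
  surjective morphism `Spec ℂ → Spec ℝ` of integral normal schemes, along which `𝒪(Spec ℝ) → 𝒪(Spec ℂ)`
  is not an isomorphism. (Normality of the target is load-bearing as well — the normalisation of a cuspidal
  cubic — but cusps are not yet in the tree; paper only.)

No statement here asserts a Theses decl (the mutated stub appears only under a negation).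

References: The Stacks project, Tag 0AY8 (More on Morphisms, Lemma 37.53.6); R. Hartshorne, *Algebraic
Geometry* (1977), proof of III Cor. 11.4.
-/

-- `Summit.HodgeConjecture.HodgeConjecture.…` is the prescribed namespace of a single-conjunct summit (D-0017).
set_option linter.dupNamespace false

namespace Summit.HodgeConjecture.HodgeConjecture.Theorems.FormalVectorBundlesAlgebraize.Negative

open CategoryTheory AlgebraicGeometry

universe u

/-! ### Redundant hypotheses of stubs 3 and 5 -/

/-- STUB 3 (`BirationalOntoNormal`): `Surjective ρ` follows from the other hypotheses — a universally
closed morphism which is an isomorphism over a dense open `U` has closed image containing `U`. [folklore] -/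
theorem surjective_of_dense_isIso_restrict {X' X : Scheme.{u}} (ρ : X' ⟶ X) [UniversallyClosed ρ]
    (U : X.Opens) (hU : Dense (U : Set X)) [IsIso (ρ ∣_ U)] : Surjective ρ := by
  have hsub : (U : Set X) ⊆ Set.range ρ.base := by
    intro x hx
    obtain ⟨y, hy⟩ := (ρ ∣_ U).surjective ⟨x, hx⟩
    refine ⟨y.1, ?_⟩
    have := congrArg Subtype.val hy
    rwa [morphismRestrict_base_coe] at this
  have hr : Set.range ρ.base = Set.univ := by
    apply Set.eq_univ_of_univ_subset
    rw [← hU.closure_eq]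
    exact closure_minimal hsub ρ.isClosedMap.isClosed_range
  exact ⟨fun x => by
    have hx : x ∈ Set.range ρ.base := hr ▸ Set.mem_univ x
    exact hx⟩

/-- STUB 5 (`PushforwardTransport`) and the output of STUB 2 (`ChowCover`): `IsProper ρ.left` follows from
`W`-projectivity of the source and separatedness of the structure map of the target. [folklore] -/
theorem isProper_left_of_isProjOver {R : Type u} [CommRing R]
    {𝒳' 𝒳 : Literature.AlgebraicGeometry.Motives.SchemeOver R} (ρ : 𝒳' ⟶ 𝒳)
    (h : Literature.AlgebraicGeometry.Resolution.ChowLemmaRing.IsProjOver 𝒳') [IsSeparated 𝒳.hom] :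
    IsProper ρ.left := by
  have h1 : IsProper 𝒳'.hom := h.isProper
  rw [← Over.w ρ] at h1
  exact IsProper.of_comp ρ.left 𝒳.hom

/-! ### STUB 3 without birationality is false -/

/-- A field is integrally closed: its fraction ring adds no elements
(Mathlib `IsField.localization_map_bijective`). [folklore] -/
theorem isIntegrallyClosed_of_isField {R : Type u} [CommRing R] (hR : IsField R) :
    IsIntegrallyClosed R := by
  haveI : Nontrivial R := ⟨hR.exists_pair_ne⟩
  refine (isIntegrallyClosed_iff (FractionRing R)).mpr fun {x} _ => ?_
  exact (IsField.localization_map_bijective (M := nonZeroDivisors R) (Rₘ := FractionRing R)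
    zero_notMem_nonZeroDivisors hR).2 x

/-- The stalks of `Spec K`, `K` a field, are integrally closed (the unique stalk is the function field).
[folklore] -/
theorem isIntegrallyClosed_stalk_specField (K : Type) [Field K] (x : Spec (CommRingCat.of K)) :
    IsIntegrallyClosed ((Spec (CommRingCat.of K)).presheaf.stalk x) := by
  obtain rfl : x = genericPoint (Spec (CommRingCat.of K)) := Subsingleton.elim _ _
  exact isIntegrallyClosed_of_isField (Field.toIsField (Spec (CommRingCat.of K)).functionField)

/-- **Birationality is load-bearing in STUB 3** (`BirationalOntoNormal` of
`Lines/chow-zariski-pushforward.lean` with its hypothesis `∃ U : X.Opens, Dense U ∧ IsIso (ρ ∣_ U)` dropped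
is false). Witness: `ρ = Spec (ℝ → ℂ) : Spec ℂ → Spec ℝ` is
finite (hence proper) and surjective, `Spec ℂ`, `Spec ℝ` are integral with integrally closed stalks, but
`ρ.app ⊤`, conjugate to `ℝ → ℂ` under `Scheme.ΓSpecIso`, is not an isomorphism (`Complex.I` is not
real). [folklore] -/
theorem not_birationalOntoNormal_without_birational :
    ¬ ∀ (X' X : Scheme.{0}) (ρ : X' ⟶ X), IsIntegral X' → IsIntegral X →
        (∀ x : X, IsIntegrallyClosed (X.presheaf.stalk x)) → IsProper ρ → Surjective ρ →
        ∀ U : X.Opens, IsIso (ρ.app U) := by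
  intro H
  let f : CommRingCat.of ℝ ⟶ CommRingCat.of ℂ := CommRingCat.ofHom (algebraMap ℝ ℂ)
  haveI : IsFinite (Spec.map f) := by
    rw [IsFinite.SpecMap_iff, CommRingCat.hom_ofHom, RingHom.finite_algebraMap]
    exact inferInstanceAs (Module.Finite ℝ ℂ)
  have hsurj : Surjective (Spec.map f) := ⟨fun x => ⟨default, Subsingleton.elim _ _⟩⟩
  have h := H (Spec (.of ℂ)) (Spec (.of ℝ)) (Spec.map f) inferInstance inferInstance
    (isIntegrallyClosed_stalk_specField ℝ) inferInstance hsurj ⊤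
  have hf : IsIso f := by
    have e : f = (Scheme.ΓSpecIso (.of ℝ)).inv ≫ (Spec.map f).appTop ≫ (Scheme.ΓSpecIso (.of ℂ)).hom := by
      rw [← Category.assoc, ← Scheme.ΓSpecIso_inv_naturality, Category.assoc, Iso.inv_hom_id,
        Category.comp_id]
    rw [e]
    change IsIso ((Scheme.ΓSpecIso (.of ℝ)).inv ≫ (Spec.map f).app ⊤ ≫ (Scheme.ΓSpecIso (.of ℂ)).hom)
    infer_instance
  obtain ⟨r, hr⟩ := (ConcreteCategory.bijective_of_isIso f).2 Complex.I
  have him := congrArg Complex.im hr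
  simp [f] at him

/-! ### STUB 2 without `Surjective 𝒳.hom` is false -/

/-- A scheme with a point has a non-trivial ring of global sections (the stalk at the point is a local
ring and receives a ring map from the global sections). [folklore] -/
theorem nontrivial_sections_of_nonempty (Y : Scheme.{u}) (y : Y) : Nontrivial Γ(Y, ⊤) := by
  by_contra h
  rw [not_nontrivial_iff_subsingleton] at h
  have : Subsingleton (Y.presheaf.stalk y) := (Y.presheaf.germ ⊤ y trivial).hom.codomain_trivial
  exact false_of_nontrivial_of_subsingleton (Y.presheaf.stalk y)

/-- **`Surjective 𝒳.hom` is load-bearing in STUB 2** (`ChowCover` of `Lines/chow-zariski-pushforward.lean`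
with the hypothesis `Surjective 𝒳.hom` dropped is false): the proper integral `W(𝔽₂)`-scheme
`𝒳 = Spec 𝔽₂` (the closed point) admits no `W`-FLAT `𝒳'` with a surjection `𝒳' → 𝒳` — on an affine open
`V` of `𝒳'`, `Γ(V)` is flat over `Γ(Spec W) ≅ W ∋ 2 ≠ 0` while `2 = 0` in `Γ(V)` (it is an `𝔽₂`-algebra
through `𝒳' → Spec 𝔽₂`), so `Γ(V) = 0` and `V = ∅`. [folklore] -/
theorem not_chowCover_without_surjective :
    ¬ ∀ (p : ℕ) [Fact p.Prime] (k : Type) [Field k] [CharP k p] [PerfectRing k p]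
        (𝒳 : Literature.AlgebraicGeometry.Motives.SchemeOver (WittVector p k)),
        IsProper 𝒳.hom → IsIntegral 𝒳.left →
        ∃ (𝒳' : Literature.AlgebraicGeometry.Motives.SchemeOver (WittVector p k)) (ρ : 𝒳' ⟶ 𝒳),
          IsIntegral 𝒳'.left ∧ Literature.AlgebraicGeometry.Resolution.ChowLemmaRing.IsProjOver 𝒳' ∧
            Flat 𝒳'.hom ∧ IsProper ρ.left ∧ Surjective ρ.left ∧
              ∃ U : 𝒳.left.Opens, Dense (U : Set 𝒳.left) ∧ IsIso (ρ.left ∣_ U) := by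
  intro H
  haveI : Fact (Nat.Prime 2) := ⟨Nat.prime_two⟩
  -- `𝒳 = Spec 𝔽₂` over `W = W(𝔽₂)` via the residue map `W → 𝔽₂`
  let W := WittVector 2 (ZMod 2)
  let c : CommRingCat.of W ⟶ CommRingCat.of (ZMod 2) := CommRingCat.ofHom WittVector.constantCoeff
  let 𝒳 : Literature.AlgebraicGeometry.Motives.SchemeOver W := Over.mk (Spec.map c)
  haveI : IsClosedImmersion (Spec.map c) :=
    IsClosedImmersion.spec_of_surjective c (WittVector.constantCoeff_surjective (p := 2))
  have hprop : IsProper 𝒳.hom := inferInstanceAs (IsProper (Spec.map c))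
  have hint : IsIntegral 𝒳.left := inferInstanceAs (IsIntegral (Spec (CommRingCat.of (ZMod 2))))
  obtain ⟨𝒳', ρ, hint', -, hflat, -, -, -⟩ := H 2 (ZMod 2) 𝒳 hprop hint
  haveI := hint'
  haveI := hflat
  -- a point of `𝒳'` and an affine open `V` around it
  obtain ⟨x⟩ := (inferInstance : Nonempty 𝒳'.left)
  obtain ⟨_, ⟨(V : 𝒳'.left.Opens), (hV : IsAffineOpen V), rfl⟩, hxV, -⟩ :=
    𝒳'.left.isBasis_affineOpens.exists_subset_of_mem_open (Set.mem_univ x) isOpen_univ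
  haveI : IsAffine V := hV
  -- `Γ(V)` is flat over `Γ(Spec W)`
  let g : (V : Scheme) ⟶ Spec (CommRingCat.of W) := V.ι ≫ 𝒳'.hom
  haveI : Flat g := inferInstance
  have hgflat : (g.appTop).hom.Flat := HasRingHomProperty.appTop (P := @Flat) g inferInstance
  letI := (g.appTop).hom.toAlgebra
  have hflatM : Module.Flat Γ(Spec (CommRingCat.of W), ⊤) Γ(V, ⊤) := hgflat
  -- `2 = 0` in `Γ(V)`: `V → 𝒳' → Spec 𝔽₂`
  have h2 : (2 : Γ(V, ⊤)) = 0 := by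
    have h0 : (2 : Γ(𝒳.left, ⊤)) = 0 := by
      change (2 : Γ(Spec (CommRingCat.of (ZMod 2)), ⊤)) = 0
      rw [← map_ofNat (Scheme.ΓSpecIso (CommRingCat.of (ZMod 2))).inv.hom 2]
      change (Scheme.ΓSpecIso (CommRingCat.of (ZMod 2))).inv.hom ((2 : ZMod 2)) = 0
      rw [show (2 : ZMod 2) = 0 from rfl, map_zero]
    rw [← map_ofNat (V.ι ≫ ρ.left).appTop.hom 2, h0, map_zero]
  -- `2 ≠ 0` is a non-zero-divisor of the domain `Γ(Spec W) ≅ W`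
  let eR : W ≃+* Γ(Spec (CommRingCat.of W), ⊤) := (Scheme.ΓSpecIso (.of W)).symm.commRingCatIsoToRingEquiv
  haveI : IsDomain Γ(Spec (CommRingCat.of W), ⊤) := MulEquiv.isDomain W eR.symm.toMulEquiv
  have h2R : (2 : Γ(Spec (CommRingCat.of W), ⊤)) ≠ 0 := by
    rw [← map_ofNat eR 2]
    intro h
    exact WittVector.p_nonzero 2 (ZMod 2) (eR.injective (h.trans (map_zero eR).symm))
  have hreg : IsSMulRegular Γ(V, ⊤) (2 : Γ(Spec (CommRingCat.of W), ⊤)) :=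
    Module.Flat.isSMulRegular_of_nonZeroDivisors (mem_nonZeroDivisors_of_ne_zero h2R)
  -- hence `Γ(V) = 0`, contradicting `x ∈ V`
  have hsub : Subsingleton Γ(V, ⊤) := ⟨fun a b => hreg (by
    change (g.appTop).hom 2 * a = (g.appTop).hom 2 * b
    rw [map_ofNat, h2, zero_mul, zero_mul])⟩
  haveI := nontrivial_sections_of_nonempty (V : Scheme) ⟨x, hxV⟩
  exact false_of_nontrivial_of_subsingleton Γ(V, ⊤)

end Summit.HodgeConjecture.HodgeConjecture.Theorems.FormalVectorBundlesAlgebraize.Negative
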